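import Summits.MatrixMultiplication.MatrixMultiplication.Theses.IsotypicSaturation
import Literature.Computability.AlgebraicComplexity.QuantumFunctionalsPolytopeMonotone

/-!
# MatrixMultiplication / IsotypicSaturation — support item `QuantumFunctionalsSaturated`
(stmt-MatrixMultiplication-4421)

Route `MatrixMultiplication/IsotypicSaturation`, item `stmt-MatrixMultiplication-4421` (support, rank 9):
**every quantum functional point `F^θ` (`θ` in the probability simplex on `Fin 3`) is monotone under
inclusion of moment polytopes** — if every partition triple `λ ⊢ n` occurring in `s^{⊗n}` (the three
isotypic character sums do not kill `kroneckerPow s n`) has a multiple `k·λ` occurring in `t^{⊗kn}`,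
then `quantumFunctionalPoint θ s ≤ quantumFunctionalPoint θ t`, for complex tensors `s`, `t` of
arbitrary finite formats.

This is the consistency / converse half of the route's crux `SaturatedPointsAreQuantum`. The
mathematics is Christandl–Vrana–Zuiddam, *Universal points in the asymptotic spectrum of tensors*
(J. AMS 36 (2023)), Def. 3.3, Thm. 3.30 (`E_θ = E^θ`, proved in tree as
`upperLogQuantumFunctional_eq_logQuantumFunctional`) and Cor. 3.31: `E^θ(s)` is a supremum of
`θ`-weighted entropies over admissible tuples, every admissible tuple extends to an occurring triple
with the same weighted entropy (completeness `∑_λ P_λ = 1` on the legs outside `supp θ`), its multiple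
`k·λ` occurs for `t` and has the same normalised entropies `H(kλ/(kn)) = H(λ/n)`. All of this is
carried out in the Literature file `QuantumFunctionalsPolytopeMonotone.lean`
(`quantumFunctionalPoint_le_of_dominated`, proved, whose domination hypothesis has literally the
shape used by the route); the present file is the glue whose type is the route decl verbatim.
-/

set_option linter.dupNamespace false

noncomputable section

namespace Summit.MatrixMultiplication.MatrixMultiplication.Theorems

open Literature.Computability.AlgebraicComplexity

/-- **Support item `QuantumFunctionalsSaturated` of route IsotypicSaturation**
(stmt-MatrixMultiplication-4421), exact route decl: for every `θ ∈ stdSimplex ℝ (Fin 3)` and complex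
tensors `s : ι → κ → μ → ℂ`, `t : ι' → κ' → μ' → ℂ` on finite index types, if every partition triple
occurring in a power `s^{⊗n}` (`n > 0`) has a multiple `k·λ` (`k > 0`) occurring in `t^{⊗kn}`, then
`quantumFunctionalPoint θ s ≤ quantumFunctionalPoint θ t` (Christandl–Vrana–Zuiddam 2023, Thm. 3.30 /
Cor. 3.31; tree: `quantumFunctionalPoint_le_of_dominated`). -/
theorem quantumFunctionalsSaturated_proof :
    Summit.MatrixMultiplication.MatrixMultiplication.Theses.IsotypicSaturation.QuantumFunctionalsSaturated := by
  unfold Summit.MatrixMultiplication.MatrixMultiplication.Theses.IsotypicSaturation.QuantumFunctionalsSaturated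
  intro θ hθ ι κ μ ι' κ' μ' _ _ _ _ _ _ s t hdom
  exact quantumFunctionalPoint_le_of_dominated hθ s t hdom

end Summit.MatrixMultiplication.MatrixMultiplication.Theorems
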